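import Summits.Schanuel.Schanuel.Theses.RoyCriterion
import Literature.NumberTheory.Transcendental.RoySmallValueMain
import Summits.Schanuel.Schanuel.Theorems.RoyCriterionRoySmallValueDirichletGapDefs

/-!
# Route `RoyCriterion`, crux `RoySmallValueDirichletGap` (stmt-Schanuel-1050), line
# `two-sided-absorption-transfer` — stub `StubRoyRegime`

## What is proved

`stub_royRegime` — **Roy's regime in the link currency**: for exponents `1 < τ < 2`, `τ < β` and
`δ > δ_R := (τ−1)(2−τ)/(β+1−τ)`, no point `(ξ, η)` carries enemy links, `¬ HasLinks ξ η β τ δ`.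

Informally: an enemy link at level `D` (a finite point set `P ⊂ ℂ³`, a height parameter `h ≥ 0`
and a level `1 ≤ D* < D` with `h ≤ C (D*)^{1+β−τ}`, the Step-2 mass clause at depth `T = ⌊D^τ⌋`
and the Step-4 clause at depth `T* = ⌊(D*)^τ⌋`) yields, by `IsLink.combined`, Roy's inequality
`(D^δ/C)(D^β #P + D h) ≤ (T/T* + 1) · C ((D*)^β #P + D* h)`.  If such links existed at every
large level, the tree's abstract Step 5 `Roy2013.endgame` (with `κ = 1/C₁²`, `A = C₁`,
`A₃ = C₁²`, `d = #P`, `h(Z) = C₁ h`, after raising the constant to `C₁ = max C 1` by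
`IsLink.mono`) forces `δ ≤ δ_R`, contradicting the hypothesis.  This is verbatim the exponent
bookkeeping of [Roy2013, §7, Step 5, p. 19].

## Design

Pure real-analysis glue, no definitions: the data function demanded by `Roy2013.endgame` is read
off the clauses of the link at the level `D = max D₀ ⌈N⌉` (where `D₀` is the eventual threshold of
`HasLinks`), exactly as `IsLink.rpow_Ds_le` feeds `Roy2013.endgame_step`.

## References

* [Roy2013] D. Roy, *A small value estimate for 𝔾ₐ × 𝔾ₘ*, Mathematika 59 (2013), 333–363
  (arXiv:1301.0663), §7.
-/

-- `Summit.Schanuel.Schanuel.…` is the mandated layout of this single-problem summit (CONVENTIONS §1).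
set_option linter.dupNamespace false

noncomputable section

namespace Summit.Schanuel.Schanuel.Theorems.RoyLinks

open Filter MvPolynomial Finset Height
open Literature.NumberTheory.Transcendental
open Literature.NumberTheory.Transcendental.Roy2013
open Summit.Schanuel.Schanuel.Theses.RoyCriterion (RoySmallValueDirichletGap)

/-! ## Stub `StubRoyRegime` -/

/-- **Roy's regime in the link currency (calibration stub of line `two-sided-absorption-transfer`).**
For `δ > δ_R = (τ−1)(2−τ)/(β+1−τ)` no point carries enemy links: Roy 2013, §7, Step 5, run on the
link clauses (`IsLink.combined` + `Roy2013.endgame`). [cite: Roy2013, §7, Step 5, p. 19] -/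
theorem stub_royRegime (ξ η : ℂ) (β τ δ : ℝ) (h1 : 1 < τ) (h2 : τ < 2) (hβ : τ < β)
    (hδR : (τ - 1) * (2 - τ) / (β + 1 - τ) < δ) : ¬HasLinks ξ η β τ δ := by
  rintro ⟨C, -, hev⟩
  -- `δ > 0` since `δ_R ≥ 0`
  have hδ0 : 0 < δ := by
    have : 0 ≤ (τ - 1) * (2 - τ) / (β + 1 - τ) :=
      div_nonneg (mul_nonneg (by linarith) (by linarith)) (by linarith)
    linarith
  have hτ0 : 0 ≤ τ := by linarith
  obtain ⟨D₀, hD₀⟩ := Filter.eventually_atTop.mp hev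
  -- raise the constant to `C₁ = max C 1 ≥ 1`
  obtain ⟨C₁, hC₁def⟩ : ∃ C₁ : ℝ, C₁ = max C 1 := ⟨_, rfl⟩
  have hCC₁ : C ≤ C₁ := by rw [hC₁def]; exact le_max_left _ _
  have hC₁1 : 1 ≤ C₁ := by rw [hC₁def]; exact le_max_right _ _
  have hC₁ : 0 < C₁ := by linarith
  refine endgame (τ := τ) (β := β) (δ := δ) (κ := 1 / C₁ ^ 2) (A := C₁) (A₃ := C₁ ^ 2)
    h1.le hβ hδ0 hδR (by positivity) hC₁ (by positivity) fun N => ?_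
  -- the level `D`
  obtain ⟨D, hDdef⟩ : ∃ D : ℕ, D = max D₀ ⌈N⌉₊ := ⟨_, rfl⟩
  have hDN : N ≤ D := by
    rw [hDdef]; exact le_trans (Nat.le_ceil N) (by exact_mod_cast le_max_right _ _)
  have hD₀D : D₀ ≤ D := by rw [hDdef]; exact le_max_left _ _
  obtain ⟨P, h, Ds, hL⟩ := hD₀ D hD₀D
  have hL₁ : IsLink C₁ ξ η β τ δ D P h Ds := hL.mono hCC₁
  have hcomb := hL₁.combined hτ0
  obtain ⟨-, -, -, hne, hDs1, hDsD, -, hh0, hh, -, -, -⟩ := hL₁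
  have hd1 : (1 : ℝ) ≤ P.card := by exact_mod_cast hne.card_pos
  have hd0 : (0 : ℝ) ≤ P.card := by linarith
  have hDs1r : (1 : ℝ) ≤ Ds := by exact_mod_cast hDs1
  have hDsDr : (Ds : ℝ) ≤ D := by exact_mod_cast hDsD.le
  have hD1 : (1 : ℝ) ≤ D := hDs1r.trans hDsDr
  have hT : ((⌊(D : ℝ) ^ τ⌋₊ : ℕ) : ℝ) ≤ (D : ℝ) ^ τ := natFloor_rpow_le D τ
  have hTs : (0 : ℝ) < (⌊(Ds : ℝ) ^ τ⌋₊ : ℕ) := by exact_mod_cast one_le_natFloor_rpow hDs1 hτ0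
  have hTs2 : (Ds : ℝ) ^ τ ≤ 2 * (⌊(Ds : ℝ) ^ τ⌋₊ : ℕ) := rpow_le_two_mul_natFloor hDs1 hτ0
  have hDδ : (0 : ℝ) ≤ (D : ℝ) ^ δ := Real.rpow_nonneg (by linarith) _
  have hDβ : (0 : ℝ) ≤ (D : ℝ) ^ β := Real.rpow_nonneg (by linarith) _
  -- the combined inequality in the shape of `endgame` (`κ = 1/C₁²`, `A = C₁`, `h(Z) = C₁ h`)
  have hineq : 1 / C₁ ^ 2 * (D : ℝ) ^ δ * ((D : ℝ) ^ β * P.card + D * (C₁ * h)) ≤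
      ((⌊(D : ℝ) ^ τ⌋₊ : ℝ) / ⌊(Ds : ℝ) ^ τ⌋₊ + 1) *
        (C₁ * (Ds : ℝ) ^ β * P.card + Ds * (C₁ * h)) := by
    have e2 : C₁ * (Ds : ℝ) ^ β * P.card + Ds * (C₁ * h) =
        C₁ * ((Ds : ℝ) ^ β * P.card + Ds * h) := by ring
    rw [e2]
    refine le_trans ?_ hcomb
    -- `(1/C₁²) D^δ (D^β d + D C₁ h) ≤ (1/C₁) D^δ (D^β d + D h)` as `C₁ ≥ 1`
    have hinv : 1 / C₁ ^ 2 ≤ 1 / C₁ := by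
      rw [div_le_div_iff_of_pos_left one_pos (by positivity) hC₁]; nlinarith
    have t1 : 1 / C₁ ^ 2 * (D : ℝ) ^ δ * ((D : ℝ) ^ β * P.card) ≤
        1 / C₁ * (D : ℝ) ^ δ * ((D : ℝ) ^ β * P.card) :=
      mul_le_mul_of_nonneg_right (mul_le_mul_of_nonneg_right hinv hDδ) (mul_nonneg hDβ hd0)
    have t2 : 1 / C₁ ^ 2 * (D : ℝ) ^ δ * (D * (C₁ * h)) = 1 / C₁ * (D : ℝ) ^ δ * (D * h) := by
      field_simp
    have e1 : (D : ℝ) ^ δ / C₁ * ((D : ℝ) ^ β * P.card + D * h) =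
        1 / C₁ * (D : ℝ) ^ δ * ((D : ℝ) ^ β * P.card) + 1 / C₁ * (D : ℝ) ^ δ * (D * h) := by
      ring
    rw [e1, mul_add, t2]
    linarith
  exact ⟨D, hDN, Ds, P.card, C₁ * h, ((⌊(D : ℝ) ^ τ⌋₊ : ℕ) : ℝ), ((⌊(Ds : ℝ) ^ τ⌋₊ : ℕ) : ℝ),
    hDs1r, hDsDr, hd1, mul_nonneg hC₁.le hh0,
    (by have := mul_le_mul_of_nonneg_left hh hC₁.le; nlinarith), Nat.cast_nonneg _, hT, hTs,
    hTs2, hineq⟩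

end Summit.Schanuel.Schanuel.Theorems.RoyLinks

end
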